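import Mathlib
import HarnessLib
import Summits.HubbardSuperconductivity.HubbardSuperconductivity.Theorems.KLProgrammeC4aPPKernelFarSFlatness

/-!
# Route `KLProgramme` — crux C4a, S3 brick (B4) «(B4)-UMK1», «(U1)-FARS-ROWS» part 5: the FLATNESS ROW `hflat` of the smooth far piece —
# constant weight `|∫_{lo}^{hi} ∂ᵤA_s(e,D−e) de| ≤ (I_A + κ₀lo)/D²` for `2Λ ≤ D ≤ hi/t₁`, and the row with a Lipschitz-anchored weight for every `0 < D ≤ hi/t₁`

Cell `gate-hubbard-kl`, seat hubbard-kl-k3c3-p1 (g17; row «δμ-flow with klAngularMean constant piece»).  Assembly of part 3's identity with part 4's sizes: the defect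
integral is split at `m = max lo (min Λ c)` and `c = max lo (min hi (t₁D))` (near-shell loop levels / far loop levels / dead), `Φ(hi) = 0` (`D ≤ hi/t₁`), `|Φ(lo)| ≤ κ₀lo`;
the weight `wt = wt(lo) + (wt − wt(lo))` with `|wt − wt(lo)| ≤ W′(e−lo)` sees only the alive range `e < t₁D` (`Bfl = W′t₁²C₁ᴬ/(1−t₁)²`); below `2Λ` the envelope
`C₁ᴬ/e²` (`4C₁ᴬ(Λ/lo)²·lo/max(D,lo)²`).
* `deriv_farS_antidiag_eq_zero_of_ge`, `abs_deriv_farS_antidiag_le` (alive ⟹ `≤ C₁ᴬ/((1−t₁)D)²`), **`abs_farFlatness_line_le_of_ge`**, **`farS_hflat_row`** (THE ROW: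
  `|∫_{lo}^{hi} wt·∂ᵤA_s(e,D−e)| ≤ Afl·lo/max(D,lo)² + Bfl`, `Afl = W·X_A`, `X_A = 4C₁ᴬ(Λ/lo)² + κ₀((6B₁+5/2)(Λ/lo) + (Λ/lo)/(2(1−t₁)) + 6/(β·lo) + 1) + κ₁(1/(2(1−t₁)) + t₁/(1−t₁))`).
Pure real analysis; nothing asserts (C), K3, the window or superconductivity.
References: BGM 2006 §2.4 (2.36) [cite: BenfattoGiulianiMastropietro2006]; FST II CPAM 51 (1998) §3 [cite: FeldmanSalmhoferTrubowitz1998].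
-/

noncomputable section

namespace Summit.HubbardSuperconductivity.HubbardSuperconductivity.Theorems.C4a

set_option linter.dupNamespace false -- summit = problem name (single-conjunct summit), D-0017

open Real Filter Set MeasureTheory intervalIntegral
open scoped Topology Interval
open Literature.MathematicalPhysics.QuantumLattice Literature.Analysis.SpecialFunctions

section Row

variable {β Λ : ℝ} (hβ : 0 < β) (hΛ : 0 < Λ) {B₁ B₂ : ℝ} (hB₁ : ∀ x, |deriv salmhoferCutoff x| ≤ B₁) (hB₂ : ∀ x, |deriv (deriv salmhoferCutoff) x| ≤ B₂)
  {κ κ' κ'' : ℝ → ℝ} (hκ : ∀ t, HasDerivAt κ (κ' t) t) (hκ'c : Continuous κ')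
  {κ₀ κ₁ : ℝ} (hκb : ∀ t ∈ Icc 0 1, |κ t| ≤ κ₀) (hκ'b : ∀ t ∈ Icc 0 1, |κ' t| ≤ κ₁)
  {t₁ : ℝ} (ht₀ : 0 < t₁) (ht25 : t₁ ≤ 2 / 5)
  (hκs : ∀ t, t₁ ≤ t → κ t = 0) (hκ's : ∀ t, t₁ ≤ t → κ' t = 0) (hκ''s : ∀ t, t₁ ≤ t → κ'' t = 0)
  {lo hi : ℝ} (hlo : 0 < lo) (hloΛ : lo ≤ Λ) (hlohi : lo ≤ hi)

include hβ hΛ hB₁ hκ ht₀ ht25 hκs hκ's hκ''s hlo in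
/-- Dead beyond `t₁D`: `0 ≤ D`, `0 < e`, `t₁D ≤ e` ⟹ `∂ᵤA_s(e, D−e) = 0`. [folklore] -/
theorem deriv_farS_antidiag_eq_zero_of_ge {D e : ℝ} (hD : 0 ≤ D) (he : 0 < e) (hge : t₁ * D ≤ e) :
    deriv (fun v : ℝ => ppFarKernelS β Λ κ lo e v) (D - e) = 0 := by
  obtain ⟨h0, h1⟩ := farS_antidiag_dead ht₀ ht25 hκs hκ's hκ''s hlo hD he hge
  rw [(hasDerivAt_ppFarKernelS_u hβ hΛ hB₁ hκ hlo e (D - e)).deriv, h0, h1]; ring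

set_option maxHeartbeats 400000 in
include hβ hΛ hB₁ hB₂ hκ hκb hκ'b ht₀ ht25 hκs hκ's hκ''s hlo in
/-- On the anti-diagonal `|∂ᵤA_s(e,D−e)| ≤ C₁ᴬ/((1−t₁)D)²` (`0 < D`, `0 < e`; alive ⟹ `|D−e| ≥ (1−t₁)D`, dead ⟹ `0`). [cite: BenfattoGiulianiMastropietro2006, §2.4 (2.36)] -/
theorem abs_deriv_farS_antidiag_le {D e : ℝ} (hD : 0 < D) (he : 0 < e) :
    |deriv (fun v : ℝ => ppFarKernelS β Λ κ lo e v) (D - e)| ≤ (κ₀ * (64 * B₂ + 108 * B₁ + 145) + κ₁ * (12 * B₁ + 9)) * (((1 - t₁) * D)⁻¹ ^ 2) := by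
  have hB0 := salmhoferB₁_nonneg hB₁
  have hB20 : 0 ≤ B₂ := (abs_nonneg _).trans (hB₂ 0)
  have hκ₀ : 0 ≤ κ₀ := (abs_nonneg _).trans (hκb 0 (left_mem_Icc.2 zero_le_one))
  have hκ₁ : 0 ≤ κ₁ := (abs_nonneg _).trans (hκ'b 0 (left_mem_Icc.2 zero_le_one))
  have ht1 : 0 < 1 - t₁ := by linarith
  rcases le_or_gt (ppSmoothScale lo (D - e)) ((1 - t₁) / t₁ * ppSmoothScale lo e) with hdead | halive
  · obtain ⟨h0, h1, -⟩ := farS_dead_of_scale_le ht₀ hκs hκ's hκ''s hlo hdead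
    rw [(hasDerivAt_ppFarKernelS_u hβ hΛ hB₁ hκ hlo e (D - e)).deriv, h0, h1]
    simp only [mul_zero, zero_mul, add_zero, abs_zero]; positivity
  · obtain ⟨-, hDu, hupos⟩ := farS_antidiag_alive ht₀ ht25 hlo hD he halive
    have h := abs_deriv_ppFarKernelS_le hβ hΛ hB₁ hB₂ hκ hκb hκ'b ht₀ ht25 hκs hκ's hκ''s hlo he.ne' (D - e)
    refine h.trans (mul_le_mul_of_nonneg_left ?_ (by positivity))
    have hM : (1 - t₁) * D ≤ max |e| |D - e| := by rw [abs_of_pos hupos]; exact hDu.trans (le_max_right _ _)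
    exact pow_le_pow_left₀ (inv_nonneg.2 ((by positivity : (0:ℝ) ≤ (1 - t₁) * D).trans hM)) (inv_anti₀ (by positivity) hM) 2

set_option maxHeartbeats 400000 in
include hβ hΛ hB₁ hκ hκ'c hκb hκ'b ht₀ ht25 hκs hκ's hκ''s hlo hloΛ hlohi in
/-- **CONSTANT-WEIGHT FLATNESS OF THE SMOOTH FAR PIECE** (`2Λ ≤ D`, `D ≤ hi/t₁`):
`D²·|∫_{lo}^{hi} ∂ᵤA_s(e,D−e) de| ≤ κ₀((6B₁+5/2)Λ + Λ/(2(1−t₁)) + 6/β) + κ₁·lo·(1/(2(1−t₁)) + t₁/(1−t₁)) + κ₀·lo`. [cite: BenfattoGiulianiMastropietro2006, §2.4 (2.36)] -/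
theorem abs_farFlatness_line_le_of_ge {D : ℝ} (hD : 2 * Λ ≤ D) (hDhi : D ≤ hi / t₁) :
    D ^ 2 * |∫ e in lo..hi, deriv (fun v : ℝ => ppFarKernelS β Λ κ lo e v) (D - e)| ≤
      κ₀ * ((6 * B₁ + 5 / 2) * Λ + Λ / (2 * (1 - t₁)) + 6 / β) + κ₁ * lo * (1 / (2 * (1 - t₁)) + t₁ / (1 - t₁)) + κ₀ * lo := by
  have hB0 := salmhoferB₁_nonneg hB₁
  have hκ₀ : 0 ≤ κ₀ := (abs_nonneg _).trans (hκb 0 (left_mem_Icc.2 zero_le_one))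
  have hκ₁ : 0 ≤ κ₁ := (abs_nonneg _).trans (hκ'b 0 (left_mem_Icc.2 zero_le_one))
  have hD0 : 0 < D := by linarith
  have ht1 : 0 < 1 - t₁ := by linarith
  have htD : t₁ * D ≤ hi := by rw [le_div_iff₀ ht₀] at hDhi; linarith
  -- the identity
  have hid := farFlatness_integral_identity hβ hΛ hB₁ hκ hκ'c hlo hD0 lo hi (κ := κ)
  rw [show D ^ 2 * |∫ e in lo..hi, deriv (fun v : ℝ => ppFarKernelS β Λ κ lo e v) (D - e)| =
      |D ^ 2 * ∫ e in lo..hi, deriv (fun v : ℝ => ppFarKernelS β Λ κ lo e v) (D - e)| by rw [abs_mul, abs_of_pos (pow_pos hD0 2)], hid,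
    farPhi_eq_zero_of_ge ht₀ ht25 hκs hκ's hκ''s hlo hD0.le (hlo.trans_le hlohi) htD, zero_sub]
  -- split points
  set c : ℝ := max lo (min hi (t₁ * D)) with hc
  set m : ℝ := max lo (min Λ c) with hm
  have hloc : lo ≤ c := le_max_left _ _
  have hchi : c ≤ hi := max_le hlohi (min_le_left _ _)
  have hlom : lo ≤ m := le_max_left _ _
  have hmc : m ≤ c := max_le hloc (min_le_right _ _)
  have hmΛ : m ≤ Λ := max_le hloΛ (min_le_left _ _)
  have hcD : c - lo ≤ t₁ * D := by
    rcases le_total lo (t₁ * D) with h | h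
    · have : c ≤ t₁ * D := max_le h (min_le_right _ _); linarith
    · have : c = lo := by rw [hc, max_eq_left (le_trans (min_le_right _ _) h)]
      rw [this]; have : 0 < t₁ * D := by positivity
      linarith
  -- the defect integrand and its continuity
  set R : ℝ → ℝ := fun e => (e * ppTrueNumeratorDu β Λ (D - e) e + (D - e) * ppTrueNumeratorDu β Λ e (D - e)) * κ (ppSmoothRatio lo e (D - e)) +
      ppTrueNumerator β Λ e (D - e) * κ' (ppSmoothRatio lo e (D - e)) *
        (lo ^ 2 * (e ^ 2 - (D - e) ^ 2) / (ppSmoothScale lo e * ppSmoothScale lo (D - e) * (ppSmoothScale lo e + ppSmoothScale lo (D - e)) ^ 2)) with hR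
  have hRc : Continuous R := by
    have hN : Continuous fun e : ℝ => ppTrueNumerator β Λ e (D - e) :=
      continuous_iff_continuousAt.2 fun e => (hasDerivAt_ppTrueNumerator_line hβ hΛ hB₁ D e).continuousAt
    have hκc : Continuous κ := continuous_iff_continuousAt.2 fun t => (hκ t).continuousAt
    have hr : Continuous fun e : ℝ => ppSmoothRatio lo e (D - e) :=
      (continuous_ppSmoothRatio₂ hlo).comp (continuous_id.prodMk (continuous_const.sub continuous_id))
    obtain ⟨hρ, -⟩ := continuous_euler_and_lineDeriv_antidiag hlo D
    exact ((((continuous_id.mul (continuous_ppTrueNumeratorDe_line hβ hΛ hB₁ D)).add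
      ((continuous_const.sub continuous_id).mul (continuous_ppTrueNumeratorDu_line hβ hΛ hB₁ D))).mul (hκc.comp hr)).add ((hN.mul (hκ'c.comp hr)).mul hρ))
  have hRi : ∀ a b : ℝ, IntervalIntegrable R volume a b := fun a b => hRc.intervalIntegrable a b
  -- (iii) beyond `c` the integrand vanishes
  have hR3 : ∫ e in c..hi, R e = 0 := by
    rcases le_total (t₁ * D) hi with h | h
    · have hcge : t₁ * D ≤ c := by rw [hc, min_eq_right h]; exact le_max_right _ _
      rw [intervalIntegral.integral_congr (g := fun _ => (0 : ℝ)) fun e he => ?_, intervalIntegral.integral_zero]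
      rw [uIcc_of_le hchi] at he
      exact farDefect_eq_zero_of_ge ht₀ ht25 hκs hκ's hκ''s hlo hD0.le (hlo.trans_le (hloc.trans he.1)) (hcge.trans he.1)
    · have : c = hi := by rw [hc, min_eq_left h, max_eq_right hlohi]
      rw [this, intervalIntegral.integral_same]
  -- (i) near-shell loop levels `(lo, m]`
  have hR1 : |∫ e in lo..m, R e| ≤ κ₀ * ((6 * B₁ + 5 / 2) * Λ + Λ / (2 * (1 - t₁)) + 2 / β) + κ₁ * lo * (1 / (2 * (1 - t₁))) := by
    set g₁ : ℝ → ℝ := fun e => κ₀ * ((6 * B₁ + 5 / 2) + β * |D - e| * Real.exp (-(β * |D - e|)) + Λ / ((1 - t₁) * D)) + κ₁ * (lo / ((1 - t₁) * D)) with hg₁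
    have hbd : ∀ᵐ e ∂volume, e ∈ Ioc lo m → ‖R e‖ ≤ g₁ e := Filter.Eventually.of_forall fun e he => by
      rw [Real.norm_eq_abs]
      exact (abs_add_le _ _).trans (add_le_add (abs_farEuler_near_le hβ hΛ hB₁ hκb ht₀ ht25 hκs hκ's hκ''s hlo hD (hlo.trans he.1) (he.2.trans hmΛ))
        (abs_farFloorDefect_le hβ hκ'b ht₀ ht25 hκs hκ's hκ''s hlo hD0 (hlo.trans he.1)))
    have hg₁i : IntervalIntegrable g₁ volume lo m := (by fun_prop : Continuous g₁).intervalIntegrable _ _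
    have hI := intervalIntegral.norm_integral_le_of_norm_le hlom hbd hg₁i
    rw [Real.norm_eq_abs] at hI
    refine hI.trans ?_
    have hth : ∫ e in lo..m, β * |D - e| * Real.exp (-(β * |D - e|)) ≤ 2 / β := by
      rw [intervalIntegral.integral_comp_sub_left (fun x : ℝ => β * |x| * Real.exp (-(β * |x|))) D]
      exact integral_beta_abs_exp_le hβ (by linarith)
    have hthi : IntervalIntegrable (fun e : ℝ => β * |D - e| * Real.exp (-(β * |D - e|))) volume lo m := (by fun_prop : Continuous fun e : ℝ => _).intervalIntegrable _ _
    have hsplit : ∫ e in lo..m, g₁ e = (κ₀ * ((6 * B₁ + 5 / 2) + Λ / ((1 - t₁) * D)) + κ₁ * (lo / ((1 - t₁) * D))) * (m - lo) +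
        κ₀ * ∫ e in lo..m, β * |D - e| * Real.exp (-(β * |D - e|)) := by
      have : g₁ = fun e => (κ₀ * ((6 * B₁ + 5 / 2) + Λ / ((1 - t₁) * D)) + κ₁ * (lo / ((1 - t₁) * D))) + κ₀ * (β * |D - e| * Real.exp (-(β * |D - e|))) := by
        funext e; simp only [hg₁]; ring
      rw [this, intervalIntegral.integral_add intervalIntegrable_const (hthi.const_mul _), intervalIntegral.integral_const, intervalIntegral.integral_const_mul,
        smul_eq_mul]; ring
    rw [hsplit]
    have hml : m - lo ≤ Λ := by linarith
    have hml0 : 0 ≤ m - lo := by linarith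
    have h1 : (κ₀ * ((6 * B₁ + 5 / 2) + Λ / ((1 - t₁) * D)) + κ₁ * (lo / ((1 - t₁) * D))) * (m - lo) ≤
        (κ₀ * ((6 * B₁ + 5 / 2) + Λ / ((1 - t₁) * D)) + κ₁ * (lo / ((1 - t₁) * D))) * Λ := mul_le_mul_of_nonneg_left hml (by positivity)
    have h2 : Λ / ((1 - t₁) * D) * Λ ≤ Λ / (2 * (1 - t₁)) := by
      rw [div_mul_eq_mul_div, div_le_div_iff₀ (by positivity) (by positivity)]
      nlinarith [mul_le_mul_of_nonneg_left hD (mul_nonneg hΛ.le ht1.le)]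
    have h3 : lo / ((1 - t₁) * D) * Λ ≤ lo * (1 / (2 * (1 - t₁))) := by
      rw [div_mul_eq_mul_div, mul_one_div, div_le_div_iff₀ (by positivity) (by positivity)]
      nlinarith [mul_le_mul_of_nonneg_left hD (mul_nonneg hlo.le ht1.le)]
    nlinarith [mul_le_mul_of_nonneg_left hth hκ₀, mul_le_mul_of_nonneg_left h2 hκ₀, mul_le_mul_of_nonneg_left h3 hκ₁]
  -- (ii) far loop levels `(m, c]`
  have hR2 : |∫ e in m..c, R e| ≤ κ₀ * (2 / β + 2 / β) + κ₁ * lo * (t₁ / (1 - t₁)) := by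
    set g₂ : ℝ → ℝ := fun e => κ₀ * (β * |e| * Real.exp (-(β * |e|)) + β * |D - e| * Real.exp (-(β * |D - e|))) + κ₁ * (lo / ((1 - t₁) * D)) with hg₂
    have hbd : ∀ᵐ e ∂volume, e ∈ Ioc m c → ‖R e‖ ≤ g₂ e := Filter.Eventually.of_forall fun e he => by
      have heΛ : Λ < e := by
        rcases le_total Λ c with h | h
        · have : m = Λ := by rw [hm, min_eq_left h, max_eq_right hloΛ]
          rw [this] at he; exact he.1
        · exfalso; have : m = c := by rw [hm, min_eq_right h, max_eq_right hloc]
          rw [this] at he; exact absurd he.2 (not_le.2 he.1)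
      have hg2e : g₂ e = κ₀ * (β * e * Real.exp (-(β * e)) + β * |D - e| * Real.exp (-(β * |D - e|))) + κ₁ * (lo / ((1 - t₁) * D)) := by
        simp only [hg₂, abs_of_pos (hΛ.trans heΛ)]
      rw [Real.norm_eq_abs, hg2e]
      exact (abs_add_le _ _).trans (add_le_add (abs_farEuler_far_le hβ hΛ hB₁ hκb ht₀ ht25 hκs hκ's hκ''s hlo hD heΛ)
        (abs_farFloorDefect_le hβ hκ'b ht₀ ht25 hκs hκ's hκ''s hlo hD0 (hΛ.trans heΛ)))
    have hg₂i : IntervalIntegrable g₂ volume m c := (by fun_prop : Continuous g₂).intervalIntegrable _ _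
    have hI := intervalIntegral.norm_integral_le_of_norm_le hmc hbd hg₂i
    rw [Real.norm_eq_abs] at hI
    refine hI.trans ?_
    have hti1 : IntervalIntegrable (fun e : ℝ => β * |e| * Real.exp (-(β * |e|))) volume m c := (by fun_prop : Continuous fun e : ℝ => _).intervalIntegrable _ _
    have hti2 : IntervalIntegrable (fun e : ℝ => β * |D - e| * Real.exp (-(β * |D - e|))) volume m c := (by fun_prop : Continuous fun e : ℝ => _).intervalIntegrable _ _
    have hth1 : ∫ e in m..c, β * |e| * Real.exp (-(β * |e|)) ≤ 2 / β := integral_beta_abs_exp_le hβ hmc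
    have hth2 : ∫ e in m..c, β * |D - e| * Real.exp (-(β * |D - e|)) ≤ 2 / β := by
      rw [intervalIntegral.integral_comp_sub_left (fun x : ℝ => β * |x| * Real.exp (-(β * |x|))) D]
      exact integral_beta_abs_exp_le hβ (by linarith)
    have hsplit : ∫ e in m..c, g₂ e = κ₀ * ((∫ e in m..c, β * |e| * Real.exp (-(β * |e|))) + ∫ e in m..c, β * |D - e| * Real.exp (-(β * |D - e|))) +
        κ₁ * (lo / ((1 - t₁) * D)) * (c - m) := by
      simp only [hg₂]
      rw [intervalIntegral.integral_add ((hti1.add hti2).const_mul _) intervalIntegrable_const, intervalIntegral.integral_const_mul,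
        intervalIntegral.integral_add hti1 hti2, intervalIntegral.integral_const, smul_eq_mul]; ring
    rw [hsplit]
    have hcm : c - m ≤ t₁ * D := by linarith
    have hcm0 : 0 ≤ c - m := by linarith
    have h3 : lo / ((1 - t₁) * D) * (c - m) ≤ lo * (t₁ / (1 - t₁)) := by
      calc lo / ((1 - t₁) * D) * (c - m) ≤ lo / ((1 - t₁) * D) * (t₁ * D) := mul_le_mul_of_nonneg_left hcm (by positivity)
        _ = lo * (t₁ / (1 - t₁)) := by field_simp
    nlinarith [mul_le_mul_of_nonneg_left (add_le_add hth1 hth2) hκ₀, mul_le_mul_of_nonneg_left h3 hκ₁]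
  -- assemble the three pieces and the boundary term at `lo`
  have hsum : ∫ e in lo..hi, R e = (∫ e in lo..m, R e) + (∫ e in m..c, R e) + ∫ e in c..hi, R e := by
    rw [intervalIntegral.integral_add_adjacent_intervals (hRi lo m) (hRi m c), intervalIntegral.integral_add_adjacent_intervals (hRi lo c) (hRi c hi)]
  have hΦlo := abs_farPhi_le hκb hlo hβ D lo (κ := κ) (Λ := Λ)
  rw [abs_of_pos hlo] at hΦlo
  have hRdef : (∫ e in lo..hi, (e * ppTrueNumeratorDu β Λ (D - e) e + (D - e) * ppTrueNumeratorDu β Λ e (D - e)) * κ (ppSmoothRatio lo e (D - e)) +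
      ppTrueNumerator β Λ e (D - e) * κ' (ppSmoothRatio lo e (D - e)) *
        (lo ^ 2 * (e ^ 2 - (D - e) ^ 2) / (ppSmoothScale lo e * ppSmoothScale lo (D - e) * (ppSmoothScale lo e + ppSmoothScale lo (D - e)) ^ 2))) =
      ∫ e in lo..hi, R e := rfl
  rw [hRdef, hsum, hR3, add_zero]
  calc |(∫ e in lo..m, R e) + (∫ e in m..c, R e) - -(lo * ppTrueNumerator β Λ lo (D - lo) * κ (ppSmoothRatio lo lo (D - lo)))|
      ≤ |∫ e in lo..m, R e| + |∫ e in m..c, R e| + |lo * ppTrueNumerator β Λ lo (D - lo) * κ (ppSmoothRatio lo lo (D - lo))| := by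
        rw [sub_neg_eq_add]; exact (abs_add_le _ _).trans (add_le_add (abs_add_le _ _) le_rfl)
    _ ≤ (κ₀ * ((6 * B₁ + 5 / 2) * Λ + Λ / (2 * (1 - t₁)) + 2 / β) + κ₁ * lo * (1 / (2 * (1 - t₁)))) + (κ₀ * (2 / β + 2 / β) + κ₁ * lo * (t₁ / (1 - t₁))) + lo * κ₀ :=
        add_le_add (add_le_add hR1 hR2) hΦlo
    _ = _ := by ring

set_option maxHeartbeats 400000 in
include hβ hΛ hB₁ hB₂ hκ hκ'c hκb hκ'b ht₀ ht25 hκs hκ's hκ''s hlo hloΛ hlohi in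
/-- **ROW `hflat` OF THE SMOOTH FAR PIECE** (box form, Lipschitz-anchored weight, every `0 < D ≤ hi/t₁`): with `C₁ᴬ = κ₀(64B₂+108B₁+145) + κ₁(12B₁+9)`,
`X_A = 4C₁ᴬ(Λ/lo)² + κ₀((6B₁+5/2)(Λ/lo) + (Λ/lo)/(2(1−t₁)) + 6/(β·lo) + 1) + κ₁(1/(2(1−t₁)) + t₁/(1−t₁))`,
`|∫_{lo}^{hi} wt(e)·∂ᵤA_s(e,D−e) de| ≤ W·X_A·lo/max(D,lo)² + W′·C₁ᴬ·t₁²/(1−t₁)²` (below `2Λ` the envelope `C₁ᴬ/e²`, above the constant-weight flatness plus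
the variation on the alive range `e < t₁D`). [cite: BenfattoGiulianiMastropietro2006, §2.4 (2.36)] -/
theorem farS_hflat_row {wt : ℝ → ℝ} {W W' : ℝ} (hwc : ContinuousOn wt (Icc lo hi)) (hwW : ∀ e ∈ Icc lo hi, |wt e| ≤ W) (hW' : 0 ≤ W')
    (hwL : ∀ e ∈ Icc lo hi, |wt e - wt lo| ≤ W' * (e - lo)) {D : ℝ} (hD : 0 < D) (hDhi : D ≤ hi / t₁) :
    |∫ e in lo..hi, wt e * deriv (fun v : ℝ => ppFarKernelS β Λ κ lo e v) (D - e)| ≤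
      W * (4 * (κ₀ * (64 * B₂ + 108 * B₁ + 145) + κ₁ * (12 * B₁ + 9)) * (Λ / lo) ^ 2 +
            (κ₀ * ((6 * B₁ + 5 / 2) * (Λ / lo) + Λ / lo / (2 * (1 - t₁)) + 6 / (β * lo) + 1) + κ₁ * (1 / (2 * (1 - t₁)) + t₁ / (1 - t₁)))) *
          (lo / max D lo ^ 2) +
        W' * (κ₀ * (64 * B₂ + 108 * B₁ + 145) + κ₁ * (12 * B₁ + 9)) * t₁ ^ 2 / (1 - t₁) ^ 2 := by
  have hB0 := salmhoferB₁_nonneg hB₁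
  have hB20 : 0 ≤ B₂ := (abs_nonneg _).trans (hB₂ 0)
  have h1t : 0 < 1 - t₁ := by linarith
  have hκ₀ : 0 ≤ κ₀ := (abs_nonneg _).trans (hκb 0 (left_mem_Icc.2 zero_le_one))
  have hκ₁ : 0 ≤ κ₁ := (abs_nonneg _).trans (hκ'b 0 (left_mem_Icc.2 zero_le_one))
  have hloI : lo ∈ Icc lo hi := left_mem_Icc.2 hlohi
  have hhiI : hi ∈ Icc lo hi := right_mem_Icc.2 hlohi
  have hW0 : 0 ≤ W := (abs_nonneg _).trans (hwW lo hloI)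
  set CA : ℝ := κ₀ * (64 * B₂ + 108 * B₁ + 145) + κ₁ * (12 * B₁ + 9) with hCA
  set IA : ℝ := κ₀ * ((6 * B₁ + 5 / 2) * (Λ / lo) + Λ / lo / (2 * (1 - t₁)) + 6 / (β * lo) + 1) + κ₁ * (1 / (2 * (1 - t₁)) + t₁ / (1 - t₁)) with hIA
  have hCA0 : 0 ≤ CA := by positivity
  have hIA0 : 0 ≤ IA := by positivity
  have hmaxlo : 0 < max D lo := lt_max_of_lt_left hD
  have hRHS0 : 0 ≤ W * (4 * CA * (Λ / lo) ^ 2 + IA) * (lo / max D lo ^ 2) + W' * CA * t₁ ^ 2 / (1 - t₁) ^ 2 := by positivity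
  -- the integrand `G e = ∂ᵤA_s(e, D−e)`
  obtain ⟨G, hGdef⟩ : ∃ G : ℝ → ℝ, G = fun e => deriv (fun v : ℝ => ppFarKernelS β Λ κ lo e v) (D - e) := ⟨_, rfl⟩
  have hGc : Continuous G := by
    rw [hGdef]
    exact (continuous_deriv_ppFarKernelS₂ hβ hΛ hB₁ hκ hlo hκ'c).comp₂ continuous_id' ((continuous_const (y := D)).sub continuous_id')
  have hGi : ∀ a b : ℝ, IntervalIntegrable G volume a b := fun a b => hGc.intervalIntegrable a b
  have hGzero : ∀ e, 0 < e → t₁ * D ≤ e → G e = 0 := fun e he heD => by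
    rw [hGdef]; exact deriv_farS_antidiag_eq_zero_of_ge hβ hΛ hB₁ hκ ht₀ ht25 hκs hκ's hκ''s hlo hD.le he heD
  have hGenv : ∀ e, 0 < e → |G e| ≤ CA / ((1 - t₁) * D) ^ 2 := fun e he => by
    rw [hGdef, div_eq_mul_inv, ← inv_pow]; exact abs_deriv_farS_antidiag_le hβ hΛ hB₁ hB₂ hκ hκb hκ'b ht₀ ht25 hκs hκ's hκ''s hlo hD he
  have hGenv' : ∀ e, 0 < e → |G e| ≤ CA / e ^ 2 := fun e he => by
    rw [hGdef]
    refine (abs_deriv_ppFarKernelS_le hβ hΛ hB₁ hB₂ hκ hκb hκ'b ht₀ ht25 hκs hκ's hκ''s hlo he.ne' (D - e)).trans ?_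
    rw [div_eq_mul_inv, ← inv_pow]
    refine mul_le_mul_of_nonneg_left (pow_le_pow_left₀ (inv_nonneg.2 (le_max_of_le_left (abs_nonneg e))) ?_ 2) hCA0
    exact inv_anti₀ he (by rw [← abs_of_pos he]; exact (le_abs_self _).trans (le_max_left _ _))
  have hwGi : ∀ a b : ℝ, a ∈ Icc lo hi → b ∈ Icc lo hi → IntervalIntegrable (fun e => wt e * G e) volume a b := fun a b ha hb =>
    ((hwc.mono (uIcc_subset_Icc ha hb)).mul hGc.continuousOn).intervalIntegrable
  have hderiv : ∀ e ∈ uIcc lo hi, wt e * deriv (fun v : ℝ => ppFarKernelS β Λ κ lo e v) (D - e) = wt e * G e := fun e _ => by rw [hGdef]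
  rw [intervalIntegral.integral_congr hderiv]
  rcases lt_or_ge D (2 * Λ) with hDΛ | hDΛ
  · -- small `D`: the envelope `|G| ≤ C₁ᴬ/e²` integrates to `W·C₁ᴬ/lo ≤ W·4C₁ᴬ(Λ/lo)²·lo/max(D,lo)²`
    have hbd : ∀ᵐ e ∂volume, e ∈ Ioc lo hi → ‖wt e * G e‖ ≤ W * CA / e ^ 2 := Filter.Eventually.of_forall fun e he => by
      have he0 : 0 < e := hlo.trans he.1
      rw [Real.norm_eq_abs, abs_mul, mul_div_assoc]
      exact mul_le_mul (hwW e ⟨he.1.le, he.2⟩) (hGenv' e he0) (abs_nonneg _) hW0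
    have hgi : IntervalIntegrable (fun e : ℝ => W * CA / e ^ 2) volume lo hi := by
      refine ContinuousOn.intervalIntegrable (continuousOn_const.div (continuousOn_pow 2) fun e he => ?_)
      rw [uIcc_of_le hlohi] at he
      exact pow_ne_zero 2 (hlo.trans_le he.1).ne'
    have hI := intervalIntegral.norm_integral_le_of_norm_le hlohi hbd hgi
    rw [Real.norm_eq_abs] at hI
    refine (hI.trans (intervalIntegral_const_div_sq_le hlo hlohi (by positivity))).trans ?_
    have hmax2 : max D lo ≤ 2 * Λ := max_le hDΛ.le (by linarith)
    have hkey : W * CA / lo ≤ W * (4 * CA * (Λ / lo) ^ 2) * (lo / max D lo ^ 2) := by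
      rw [show W * (4 * CA * (Λ / lo) ^ 2) * (lo / max D lo ^ 2) = W * CA / lo * ((2 * Λ) ^ 2 / max D lo ^ 2) by field_simp; ring]
      exact le_mul_of_one_le_right (by positivity) ((one_le_div (by positivity)).2 (pow_le_pow_left₀ hmaxlo.le hmax2 2))
    have hx : 0 ≤ W * IA * (lo / max D lo ^ 2) := by positivity
    have hy : 0 ≤ W' * CA * t₁ ^ 2 / (1 - t₁) ^ 2 := by positivity
    linarith [hkey, hx, hy]
  · -- `2Λ ≤ D`
    have ht₁D : t₁ * D ≤ hi := by rw [le_div_iff₀ ht₀] at hDhi; linarith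
    rcases le_or_gt (t₁ * D) lo with hcase | hcase
    · have h0 : ∫ e in lo..hi, wt e * G e = 0 := by
        rw [← intervalIntegral.integral_zero (a := lo) (b := hi) (μ := volume)]
        refine intervalIntegral.integral_congr fun e he => ?_
        rw [uIcc_of_le hlohi] at he
        rw [hGzero e (hlo.trans_le he.1) (hcase.trans he.1), mul_zero]
      rw [h0, abs_zero]; exact hRHS0
    · have hDlo : lo ≤ D := by linarith
      have hmax : max D lo = D := max_eq_left hDlo
      have hsum : (fun e => wt e * G e) = fun e => wt lo * G e + (wt e - wt lo) * G e := funext fun e => by ring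
      have htDI : t₁ * D ∈ Icc lo hi := ⟨hcase.le, ht₁D⟩
      have hvari : ∀ a b : ℝ, a ∈ Icc lo hi → b ∈ Icc lo hi → IntervalIntegrable (fun e => (wt e - wt lo) * G e) volume a b := fun a b ha hb => by
        have h := (hwGi a b ha hb).sub ((hGi a b).const_mul (wt lo))
        exact h.congr fun e _ => by ring
      rw [hsum, intervalIntegral.integral_add ((hGi lo hi).const_mul (wt lo)) (hvari lo hi hloI hhiI), intervalIntegral.integral_const_mul]
      -- (I) constant part from the constant-weight flatness
      have hflat := abs_farFlatness_line_le_of_ge hβ hΛ hB₁ hκ hκ'c hκb hκ'b ht₀ ht25 hκs hκ's hκ''s hlo hloΛ hlohi hDΛ hDhi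
      have hIAlo : κ₀ * ((6 * B₁ + 5 / 2) * Λ + Λ / (2 * (1 - t₁)) + 6 / β) + κ₁ * lo * (1 / (2 * (1 - t₁)) + t₁ / (1 - t₁)) + κ₀ * lo = IA * lo := by
        simp only [hIA]; field_simp; ring
      have hflat' : D ^ 2 * |∫ e in lo..hi, G e| ≤ IA * lo := by rw [hGdef, ← hIAlo]; exact hflat
      have hI : |∫ e in lo..hi, G e| ≤ IA * (lo / max D lo ^ 2) := by
        rw [hmax, show IA * (lo / D ^ 2) = IA * lo / D ^ 2 by ring, le_div_iff₀ (pow_pos hD 2)]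
        linarith
      have hconst : |wt lo * ∫ e in lo..hi, G e| ≤ W * IA * (lo / max D lo ^ 2) := by
        rw [abs_mul, mul_assoc]; exact mul_le_mul (hwW lo hloI) hI (abs_nonneg _) hW0
      -- (II) the variation part lives on `[lo, t₁D]`
      have hII : |∫ e in lo..hi, (wt e - wt lo) * G e| ≤ W' * CA * t₁ ^ 2 / (1 - t₁) ^ 2 := by
        have h1 : ∫ e in (t₁ * D)..hi, (wt e - wt lo) * G e = 0 := by
          rw [← intervalIntegral.integral_zero (a := t₁ * D) (b := hi) (μ := volume)]
          refine intervalIntegral.integral_congr fun e he => ?_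
          rw [uIcc_of_le ht₁D] at he
          have he0 : 0 < e := lt_of_lt_of_le (by positivity : 0 < t₁ * D) he.1
          rw [hGzero e he0 he.1, mul_zero]
        have hsplit2 := intervalIntegral.integral_add_adjacent_intervals (hvari lo (t₁ * D) hloI htDI) (hvari (t₁ * D) hi htDI hhiI)
        rw [← hsplit2, h1, add_zero]
        obtain ⟨M, hM⟩ : ∃ M : ℝ, M = W' * (t₁ * D) * (CA / ((1 - t₁) * D) ^ 2) := ⟨_, rfl⟩
        have hM0 : 0 ≤ M := by rw [hM]; positivity
        have hbound : ∀ e ∈ Ι lo (t₁ * D), ‖(wt e - wt lo) * G e‖ ≤ M := by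
          intro e he
          rw [uIoc_of_le hcase.le] at he
          have heI : e ∈ Icc lo hi := ⟨he.1.le, he.2.trans ht₁D⟩
          have he0 : 0 < e := hlo.trans he.1
          have hw1 : |wt e - wt lo| ≤ W' * (t₁ * D) := (hwL e heI).trans (mul_le_mul_of_nonneg_left (by linarith [he.2]) hW')
          rw [Real.norm_eq_abs, abs_mul, hM]
          exact mul_le_mul hw1 (hGenv e he0) (abs_nonneg _) (by positivity)
        have h2 := intervalIntegral.norm_integral_le_of_norm_le_const hbound
        rw [Real.norm_eq_abs, abs_of_pos (by linarith : 0 < t₁ * D - lo)] at h2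
        calc |∫ e in lo..t₁ * D, (wt e - wt lo) * G e| ≤ M * (t₁ * D - lo) := h2
          _ ≤ M * (t₁ * D) := mul_le_mul_of_nonneg_left (by linarith) hM0
          _ = W' * CA * t₁ ^ 2 / (1 - t₁) ^ 2 := by rw [hM]; field_simp
      calc |wt lo * (∫ e in lo..hi, G e) + ∫ e in lo..hi, (wt e - wt lo) * G e|
          ≤ |wt lo * ∫ e in lo..hi, G e| + |∫ e in lo..hi, (wt e - wt lo) * G e| := abs_add_le _ _
        _ ≤ W * IA * (lo / max D lo ^ 2) + W' * CA * t₁ ^ 2 / (1 - t₁) ^ 2 := add_le_add hconst hII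
        _ ≤ _ := by nlinarith [mul_nonneg (mul_nonneg hW0 (by positivity : 0 ≤ 4 * CA * (Λ / lo) ^ 2)) (by positivity : 0 ≤ lo / max D lo ^ 2)]

end Row

end Summit.HubbardSuperconductivity.HubbardSuperconductivity.Theorems.C4a

end
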